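import Summits.Ventures.QEC.Expanders.BiregularLift
import Summits.Ventures.QEC.Expanders.BiregularExpanderEstimates
import Mathlib.Algebra.Order.Field.GeomSum
import HarnessLib

/-!
# Exactly-biregular two-sided lossless expanders exist for every size (random lifts, first moment)

Venture QEC (`Summits/Ventures/QEC`), item 04.EXIST, main file. PRE-REGISTERED statement (qec STATUS
2026-08-27T07:51Z, frozen): `exists_biregular_expander` — for all `Δ_A, Δ_B : ℕ` and `δ : ℝ` with `δΔ_A > 1` and
`δΔ_B > 1` there is `γ > 0` such that for EVERY `n` some `H : Matrix (Fin Δ_A × Fin n) (Fin Δ_B × Fin n) (ZMod 2)`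
is `(Δ_A, Δ_B)`-biregular (`IsBiregular`, exact degrees) and `(γ, δ, γ, δ)`-left-right-expanding
(`IsLeftRightExpanding`, the hypotheses of the tree's quantum-expander theorems LTZ15 Thm 2 / FGL18 Prop 11 /
Thm 1 / Thm 17). The witness is an `n`-lift of `K_{Δ_B,Δ_A}` (`BiregularLift`: `liftMatrix`, biregular for every
configuration); a good configuration exists by the first-moment method (estimates in `BiregularExpanderEstimates`):

* `card_not_isLeftExpanding_le` — with `y₀ = Δ_AΔ_Bγ ≤ 1` and `K y₀^{δΔ_A-1} ≤ 1/4`, at most a THIRD of the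
  configurations fail left expansion (`Σ_{s≥1} ρ^s ≤ 1/3`);
* `liftMatrix_transpose` — the transpose of a lift is the lift of the inverted, swapped configuration, so the
  same holds on the right (`card_not_isRightExpanding_le`);
* `exists_biregular_expander` — two thirds `<` one: some configuration expands on both sides;
* `exists_biregular_expander_fgl18` / `exists_biregular_expander_ltz15` — the instances `Δ ≥ 9`, `δ = 2/17 < 1/8`
  (`β₀ > 0`) and `Δ ≥ 7`, `δ = 2/13 < 1/6`: the hypotheses of the tree's FGL18 / LTZ15 theorems are satisfiable
  for every size.

Our own elementary argument (no printed source we hold proves existence for SIMPLE exactly-biregular graphs;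
the configuration-model statement is classical: Bassalygo 1981, Sipser–Spielman 1996, Richardson–Urbanke 2008
Thm 8.7, FGL18 Thm 4; LTZ15 after Thm 2: "the graph G with the required expanding properties may be obtained by
random choice"; random lifts: Amit–Linial, "Random graph coverings I", Combinatorica 22 (2002)). All statements
PROVED (standard axioms); no named facts. Words of record (qec-lead block 68 (2)(c)): no novelty claim on the
mathematics.
-/

namespace Summit.Ventures.QEC.Expanders

open Finset Real Matrix Literature.InformationTheory.QuantumCodes

/-! ### At most a third of the lifts fail left expansion -/

section UnionBound

variable {dA dB n : ℕ}

/-- Sums over a union of events are at most the sum of the sums (nonnegative weights). [folklore] -/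
private theorem sum_biUnion_le_sum' {ι β : Type*} [DecidableEq β] (T : Finset ι) (B : ι → Finset β)
    (W : β → ℝ) (hW : ∀ b, 0 ≤ W b) : ∑ b ∈ T.biUnion B, W b ≤ ∑ a ∈ T, ∑ b ∈ B a, W b := by
  classical
  induction T using Finset.induction_on with
  | empty => simp
  | insert a T ha ih =>
    rw [Finset.biUnion_insert, Finset.sum_insert ha]
    have hu : ∑ b ∈ B a ∪ T.biUnion B, W b ≤ ∑ b ∈ B a, W b + ∑ b ∈ T.biUnion B, W b := by
      rw [← Finset.sum_union_inter]
      have : 0 ≤ ∑ b ∈ B a ∩ T.biUnion B, W b := sum_nonneg fun b _ => hW b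
      linarith
    linarith

/-- **Union bound, left side**: with `y₀ = Δ_AΔ_Bγ ≤ 1` and `K y₀^{δΔ_A-1} ≤ 1/4`, at most a third of the
configurations give a lift that is not `(γ,δ)`-left-expanding:
`3·#{π : ¬ left-expanding} ≤ |Ω|` (`Σ_{s ≥ 1} ρ^s ≤ 1/3` for `ρ ≤ 1/4`). [folklore] -/
theorem card_not_isLeftExpanding_le {δ γ : ℝ} [DecidablePred fun σ : LiftConfig dA dB n =>
      ¬ IsLeftExpanding (liftMatrix σ) dA γ δ] (hdA : 1 ≤ dA) (hdB : 1 ≤ dB) (hn : 0 < n)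
    (hδ : 1 < δ * dA) (hγ : 0 < γ) (hy0 : (dA : ℝ) * dB * γ ≤ 1)
    (hρ : Kconst dA dB * ((dA : ℝ) * dB * γ) ^ (δ * dA - 1) ≤ 1 / 4) :
    3 * ((univ.filter fun σ : LiftConfig dA dB n =>
        ¬ IsLeftExpanding (liftMatrix σ) dA γ δ).card : ℝ)
      ≤ Fintype.card (LiftConfig dA dB n) := by
  classical
  set Ω : ℝ := (Fintype.card (LiftConfig dA dB n) : ℝ) with hΩ
  set ρ : ℝ := Kconst dA dB * ((dA : ℝ) * dB * γ) ^ (δ * dA - 1) with hρdef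
  have hρ0 : 0 ≤ ρ := by
    rw [hρdef]
    exact mul_nonneg (by linarith [one_le_Kconst hdA hdB]) (Real.rpow_nonneg (by positivity) _)
  set nA : ℕ := dB * n with hnA
  set smax : ℕ := ⌊γ * nA⌋₊ with hsmax
  -- the failing event of a single set
  let Fail : Finset (Fin dB × Fin n) → Finset (LiftConfig dA dB n) := fun S =>
    univ.filter fun σ => ((leftNbhd (liftMatrix σ) S).card : ℝ) < (1 - δ) * dA * S.card
  -- the relevant sets: `1 ≤ |S| ≤ γ n_A`
  set sets : Finset (Finset (Fin dB × Fin n)) :=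
    (Finset.Icc 1 smax).biUnion fun s => (univ : Finset (Fin dB × Fin n)).powersetCard s with hsets
  have hcover : (univ.filter fun σ : LiftConfig dA dB n => ¬ IsLeftExpanding (liftMatrix σ) dA γ δ)
      ⊆ sets.biUnion Fail := by
    intro σ hσ
    rw [Finset.mem_filter] at hσ
    obtain ⟨S, hSγ, hSfail⟩ : ∃ S : Finset (Fin dB × Fin n), (S.card : ℝ) ≤ γ * Fintype.card (Fin dB × Fin n) ∧
        ¬ ((1 - δ) * dA * S.card ≤ ((leftNbhd (liftMatrix σ) S).card : ℝ)) := by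
      have h := hσ.2
      unfold IsLeftExpanding at h
      push Not at h
      obtain ⟨S, h1, h2⟩ := h
      exact ⟨S, h1, not_le.2 h2⟩
    push Not at hSfail
    have hS1 : 1 ≤ S.card := by
      by_contra h0
      push Not at h0
      have hS0 : S.card = 0 := by omega
      have h1 : (0 : ℝ) ≤ ((leftNbhd (liftMatrix σ) S).card : ℝ) := Nat.cast_nonneg _
      rw [hS0] at hSfail
      simp only [Nat.cast_zero, mul_zero] at hSfail
      linarith
    rw [Finset.mem_biUnion]
    refine ⟨S, ?_, Finset.mem_filter.2 ⟨Finset.mem_univ _, hSfail⟩⟩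
    rw [hsets, Finset.mem_biUnion]
    refine ⟨S.card, Finset.mem_Icc.2 ⟨hS1, ?_⟩, Finset.mem_powersetCard.2 ⟨Finset.subset_univ _, rfl⟩⟩
    rw [hsmax]
    refine Nat.le_floor ?_
    rw [hnA]
    simpa [Fintype.card_prod, Fintype.card_fin] using hSγ
  -- per-size bound
  have hsize : ∀ S : Finset (Fin dB × Fin n),
      ((Fail S).card : ℝ) ≤ Ω * ∑ m ∈ Finset.range ⌈(1 - δ) * dA * S.card⌉₊,
        (((dA * n).choose m : ℕ) : ℝ) * ((m : ℝ) / n) ^ (dA * S.card) := by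
    intro S
    exact card_expansionFails_le (dA := dA) S δ hn
  have hn' : (0 : ℝ) < n := by exact_mod_cast hn
  calc 3 * ((univ.filter fun σ : LiftConfig dA dB n => ¬ IsLeftExpanding (liftMatrix σ) dA γ δ).card : ℝ)
      ≤ 3 * ((sets.biUnion Fail).card : ℝ) := by
        refine mul_le_mul_of_nonneg_left ?_ (by norm_num)
        exact_mod_cast Finset.card_le_card hcover
    _ ≤ 3 * ∑ S ∈ sets, ((Fail S).card : ℝ) := by
        refine mul_le_mul_of_nonneg_left ?_ (by norm_num)
        exact_mod_cast Finset.card_biUnion_le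
    _ ≤ 3 * ∑ s ∈ Finset.Icc 1 smax, ∑ S ∈ (univ : Finset (Fin dB × Fin n)).powersetCard s,
          ((Fail S).card : ℝ) := by
        refine mul_le_mul_of_nonneg_left ?_ (by norm_num)
        rw [hsets]
        exact sum_biUnion_le_sum' _ _ _ (fun S => Nat.cast_nonneg _)
    _ ≤ 3 * ∑ s ∈ Finset.Icc 1 smax, ∑ S ∈ (univ : Finset (Fin dB × Fin n)).powersetCard s,
          Ω * ∑ m ∈ Finset.range ⌈(1 - δ) * dA * S.card⌉₊,
            (((dA * n).choose m : ℕ) : ℝ) * ((m : ℝ) / n) ^ (dA * S.card) := by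
        refine mul_le_mul_of_nonneg_left ?_ (by norm_num)
        exact Finset.sum_le_sum fun s _ => Finset.sum_le_sum fun S _ => hsize S
    _ = 3 * (Ω * ∑ s ∈ Finset.Icc 1 smax, (((dB * n).choose s : ℕ) : ℝ) *
          ∑ m ∈ Finset.range ⌈(1 - δ) * dA * s⌉₊,
            (((dA * n).choose m : ℕ) : ℝ) * ((m : ℝ) / n) ^ (dA * s)) := by
        congr 1
        rw [Finset.mul_sum]
        refine Finset.sum_congr rfl fun s _ => ?_
        rw [Finset.sum_congr rfl fun S hS => by rw [(Finset.mem_powersetCard.1 hS).2], Finset.sum_const,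
          Finset.card_powersetCard, Finset.card_univ, Fintype.card_prod, Fintype.card_fin, Fintype.card_fin,
          nsmul_eq_mul]
        ring
    _ ≤ 3 * (Ω * ∑ s ∈ Finset.Icc 1 smax, ρ ^ s) := by
        refine mul_le_mul_of_nonneg_left (mul_le_mul_of_nonneg_left ?_ (by rw [hΩ]; positivity))
          (by norm_num)
        refine Finset.sum_le_sum fun s hs => ?_
        have hs1 : 1 ≤ s := (Finset.mem_Icc.1 hs).1
        have hsγ : (s : ℝ) ≤ γ * (dB * n) := by
          have h := Nat.floor_le (show 0 ≤ γ * nA by positivity)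
          have h2 : (s : ℝ) ≤ smax := by exact_mod_cast (Finset.mem_Icc.1 hs).2
          rw [hsmax] at h2
          rw [hnA] at h h2
          push_cast at h h2
          linarith
        exact term_le_rho_pow hdA hdB hn hs1 hδ hγ hy0 hsγ
    _ ≤ 3 * (Ω * (1 / 3)) := by
        refine mul_le_mul_of_nonneg_left (mul_le_mul_of_nonneg_left ?_ (by rw [hΩ]; positivity))
          (by norm_num)
        have hIcc : Finset.Icc 1 smax = Finset.Ico 1 (smax + 1) := by
          ext s; simp only [Finset.mem_Icc, Finset.mem_Ico]; omega
        rw [hIcc]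
        have hρ1 : ρ < 1 := by linarith
        refine (geom_sum_Ico_le_of_lt_one hρ0 hρ1).trans ?_
        rw [pow_one, div_le_iff₀ (by linarith)]
        linarith
    _ = Ω := by ring

end UnionBound

/-! ### The right side by transposition -/

section Transpose

variable {dA dB n : ℕ}

/-- Right expansion of `H` is left expansion of `Hᵀ` (the tree's
`QuantumExpander.isLeftExpanding_transpose_iff`, restated to keep the imports light).
[cite: LeverrierTillichZemor2015, §2 (arXiv v1 p0005 L9-18)] -/
private theorem isLeftExpanding_transpose_iff' {A B : Type*} [Fintype A] [Fintype B] [DecidableEq A]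
    [DecidableEq B] (H : Matrix B A (ZMod 2)) (d : ℕ) (γ δ : ℝ) :
    IsLeftExpanding Hᵀ d γ δ ↔ IsRightExpanding H d γ δ := by
  simp only [IsLeftExpanding, IsRightExpanding, leftNbhd, rightNbhd, Matrix.transpose_apply]

/-- The swapped configuration: `π'_{r,l} = π_{l,r}⁻¹`. [folklore] -/
def swapConfig (σ : LiftConfig dA dB n) : LiftConfig dB dA n := fun r l => (σ l r).symm

/-- Swapping is an involution (up to the exchange of `Δ_A` and `Δ_B`). [folklore] -/
theorem swapConfig_swapConfig (σ : LiftConfig dA dB n) : swapConfig (swapConfig σ) = σ := by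
  funext l r; simp [swapConfig]

/-- **The transpose of a lift is the lift of the swapped configuration.** [folklore] -/
theorem liftMatrix_transpose (σ : LiftConfig dA dB n) : (liftMatrix σ)ᵀ = liftMatrix (swapConfig σ) := by
  ext a b
  simp only [Matrix.transpose_apply, liftMatrix, swapConfig]
  by_cases h : σ a.1 b.1 a.2 = b.2
  · have h' : (σ a.1 b.1).symm b.2 = a.2 := by rw [← h, Equiv.symm_apply_apply]
    simp [h, h']
  · have h' : ¬ (σ a.1 b.1).symm b.2 = a.2 := by
      intro h'; apply h; rw [← h', Equiv.apply_symm_apply]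
    simp [h, h']

/-- **Union bound, right side**: at most a third of the configurations give a lift that is not
`(γ,δ)`-right-expanding (the right expansion of `liftMatrix π` is the left expansion of
`liftMatrix (swapConfig π)`, and `swapConfig` is a bijection). [folklore] -/
theorem card_not_isRightExpanding_le {δ γ : ℝ} [DecidablePred fun σ : LiftConfig dA dB n =>
      ¬ IsRightExpanding (liftMatrix σ) dB γ δ] (hdA : 1 ≤ dA) (hdB : 1 ≤ dB) (hn : 0 < n)
    (hδ : 1 < δ * dB) (hγ : 0 < γ) (hy0 : (dB : ℝ) * dA * γ ≤ 1)
    (hρ : Kconst dB dA * ((dB : ℝ) * dA * γ) ^ (δ * dB - 1) ≤ 1 / 4) :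
    3 * ((univ.filter fun σ : LiftConfig dA dB n =>
        ¬ IsRightExpanding (liftMatrix σ) dB γ δ).card : ℝ)
      ≤ Fintype.card (LiftConfig dA dB n) := by
  classical
  have hL := card_not_isLeftExpanding_le (dA := dB) (dB := dA) (n := n) hdB hdA hn hδ hγ hy0 hρ
  -- transport along the bijection `swapConfig`
  have hcard : (univ.filter fun σ : LiftConfig dA dB n => ¬ IsRightExpanding (liftMatrix σ) dB γ δ).card
      = (univ.filter fun τ : LiftConfig dB dA n => ¬ IsLeftExpanding (liftMatrix τ) dB γ δ).card := by
    refine Finset.card_bij (fun σ _ => swapConfig σ) ?_ ?_ ?_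
    · intro σ hσ
      rw [Finset.mem_filter] at hσ ⊢
      refine ⟨Finset.mem_univ _, ?_⟩
      rw [← liftMatrix_transpose, isLeftExpanding_transpose_iff']
      exact hσ.2
    · intro σ _ σ' _ h
      have := congrArg swapConfig h
      rwa [swapConfig_swapConfig, swapConfig_swapConfig] at this
    · intro τ hτ
      refine ⟨swapConfig τ, ?_, swapConfig_swapConfig τ⟩
      rw [Finset.mem_filter] at hτ ⊢
      refine ⟨Finset.mem_univ _, ?_⟩
      rw [← isLeftExpanding_transpose_iff', liftMatrix_transpose, swapConfig_swapConfig]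
      exact hτ.2
  have hΩ : Fintype.card (LiftConfig dB dA n) = Fintype.card (LiftConfig dA dB n) := by
    rw [card_liftConfig, card_liftConfig, ← pow_mul, ← pow_mul, mul_comm]
  rw [hcard, ← hΩ]
  exact hL

end Transpose

/-! ### Existence -/

section Existence

/-- **Exactly-biregular two-sided lossless expanders exist for every size** (PRE-REGISTERED statement, qec
04.EXIST): for all degrees `Δ_A, Δ_B` and `δ` with `δΔ_A > 1`, `δΔ_B > 1` there is `γ > 0` (depending only on
`Δ_A, Δ_B, δ`) such that for EVERY `n` some `(Δ_A, Δ_B)`-biregular bipartite graph with parts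
`Fin Δ_B × Fin n` (columns) and `Fin Δ_A × Fin n` (rows) is `(γ, δ, γ, δ)`-left-right-expanding — an `n`-lift of
`K_{Δ_B,Δ_A}` chosen by the first-moment method (at most a third of the lifts fail on each side). With
`δ < 1/8` and `Δ ≥ 9` (FGL18) or `δ < 1/6`, `Δ ≥ 7` (LTZ15) this makes the hypotheses of the tree's
quantum-expander theorems (`LTZ15_theorem2_le_holds`, `FGL18_proposition11_le_holds`, `FGL18_theorem1_holds`,
their `Z`-sector twins) satisfiable for every size. Existence for the configuration model (multigraphs) is
classical: Sipser–Spielman 1996, Richardson–Urbanke 2008 Thm 8.7, FGL18 Thm 4. [folklore] -/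
theorem exists_biregular_expander (dA dB : ℕ) (δ : ℝ) (hA : 1 < δ * (dA : ℝ)) (hB : 1 < δ * (dB : ℝ)) :
    ∃ γ : ℝ, 0 < γ ∧ ∀ n : ℕ, ∃ H : Matrix (Fin dA × Fin n) (Fin dB × Fin n) (ZMod 2),
      Literature.InformationTheory.QuantumCodes.IsBiregular H dA dB ∧
      Literature.InformationTheory.QuantumCodes.IsLeftRightExpanding H dA dB γ δ γ δ := by
  classical
  -- degrees are positive
  have hdA : 1 ≤ dA := by
    by_contra h; push Not at h
    have : dA = 0 := by omega
    subst this; simp at hA; linarith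
  have hdB : 1 ≤ dB := by
    by_contra h; push Not at h
    have : dB = 0 := by omega
    subst this; simp at hB; linarith
  have hdA' : (1 : ℝ) ≤ dA := by exact_mod_cast hdA
  have hdB' : (1 : ℝ) ≤ dB := by exact_mod_cast hdB
  -- the two `y₀`'s and `γ`
  obtain ⟨hyL0, hyL1, hyLρ⟩ := yzero_spec (dA := dA) (dB := dB) hdA hdB hA
  obtain ⟨hyR0, hyR1, hyRρ⟩ := yzero_spec (dA := dB) (dB := dA) hdB hdA hB
  set yL : ℝ := (1 / (4 * Kconst dA dB)) ^ (1 / (δ * dA - 1)) with hyLdef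
  set yR : ℝ := (1 / (4 * Kconst dB dA)) ^ (1 / (δ * dB - 1)) with hyRdef
  set γ : ℝ := min (yL / (dA * dB)) (yR / (dB * dA)) with hγdef
  have hdd : (0 : ℝ) < dA * dB := by positivity
  have hdd' : (0 : ℝ) < dB * dA := by positivity
  have hγ0 : 0 < γ := lt_min (div_pos hyL0 hdd) (div_pos hyR0 hdd')
  -- `Δ_AΔ_Bγ ≤ y₀` on both sides, hence `≤ 1` and `ρ ≤ 1/4` by monotonicity
  have hγL : (dA : ℝ) * dB * γ ≤ yL := by
    have h := min_le_left (yL / (dA * dB)) (yR / (dB * dA))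
    rw [← hγdef] at h
    have := mul_le_mul_of_nonneg_left h hdd.le
    rwa [mul_div_cancel₀ _ hdd.ne'] at this
  have hγR : (dB : ℝ) * dA * γ ≤ yR := by
    have h := min_le_right (yL / (dA * dB)) (yR / (dB * dA))
    rw [← hγdef] at h
    have := mul_le_mul_of_nonneg_left h hdd'.le
    rwa [mul_div_cancel₀ _ hdd'.ne'] at this
  have hKL : 0 ≤ Kconst dA dB := by linarith [one_le_Kconst hdA hdB]
  have hKR : 0 ≤ Kconst dB dA := by linarith [one_le_Kconst hdB hdA]
  have hρL : Kconst dA dB * ((dA : ℝ) * dB * γ) ^ (δ * dA - 1) ≤ 1 / 4 := by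
    rw [← hyLρ]
    exact mul_le_mul_of_nonneg_left
      (Real.rpow_le_rpow (by positivity) hγL (by linarith)) hKL
  have hρR : Kconst dB dA * ((dB : ℝ) * dA * γ) ^ (δ * dB - 1) ≤ 1 / 4 := by
    rw [← hyRρ]
    exact mul_le_mul_of_nonneg_left
      (Real.rpow_le_rpow (by positivity) hγR (by linarith)) hKR
  refine ⟨γ, hγ0, fun n => ?_⟩
  rcases Nat.eq_zero_or_pos n with rfl | hn
  · -- `n = 0`: no vertices, every statement is vacuous
    refine ⟨liftMatrix (fun _ _ => Equiv.refl _), isBiregular_liftMatrix _, ?_, ?_⟩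
    · intro S _
      have hS : S = ∅ := Finset.eq_empty_of_isEmpty S
      subst hS; simp
    · intro T _
      have hT : T = ∅ := Finset.eq_empty_of_isEmpty T
      subst hT; simp
  -- `n ≥ 1`: fewer than all configurations are bad
  have hL := card_not_isLeftExpanding_le (n := n) hdA hdB hn hA hγ0 (hγL.trans hyL1) hρL
  have hR := card_not_isRightExpanding_le (n := n) hdA hdB hn hB hγ0 (hγR.trans hyR1) hρR
  by_contra hnone
  push Not at hnone
  -- every configuration fails on one side
  have hall : (univ : Finset (LiftConfig dA dB n)) ⊆
      (univ.filter fun σ : LiftConfig dA dB n => ¬ IsLeftExpanding (liftMatrix σ) dA γ δ) ∪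
        (univ.filter fun σ : LiftConfig dA dB n => ¬ IsRightExpanding (liftMatrix σ) dB γ δ) := by
    intro σ _
    rw [Finset.mem_union, Finset.mem_filter, Finset.mem_filter]
    by_contra h
    push Not at h
    exact hnone (liftMatrix σ) (isBiregular_liftMatrix σ) ⟨h.1 (Finset.mem_univ _), h.2 (Finset.mem_univ _)⟩
  have hcard := Finset.card_le_card hall
  have hΩpos : (0 : ℝ) < Fintype.card (LiftConfig dA dB n) := by
    have : 0 < Fintype.card (LiftConfig dA dB n) := Fintype.card_pos
    exact_mod_cast this
  have h1 : (Fintype.card (LiftConfig dA dB n) : ℝ) ≤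
      ((univ.filter fun σ : LiftConfig dA dB n => ¬ IsLeftExpanding (liftMatrix σ) dA γ δ).card : ℝ) +
        ((univ.filter fun σ : LiftConfig dA dB n => ¬ IsRightExpanding (liftMatrix σ) dB γ δ).card : ℝ) := by
    have h := hcard.trans (Finset.card_union_le _ _)
    rw [Finset.card_univ] at h
    exact_mod_cast h
  linarith

/-- **Non-vacuity of the FGL18 hypotheses**: for all degrees `Δ_A, Δ_B ≥ 9` there are `γ > 0` and `δ > 0`
with `β₀ = betaZero Δ_A Δ_B δ δ > 0` (here `δ = 2/17 < 1/8`) such that `(Δ_A,Δ_B)`-biregular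
`(γ,δ,γ,δ)`-expanders exist for every size — so `FGL18_proposition11_le_holds`, `FGL18_theorem1_holds`,
`FGL18_theorem17_holds`'s consumers and the `Z`-sector twins speak about a non-empty family for every `n`.
("δ_A, δ_B < 1/8 is sufficient to ensure that β₀ > 0 and there exists such expander graphs as soon as
d_A, d_B ≥ 9", FGL18 after Def 10 — there for the configuration model.) [cite: FawziGrospellierLeverrier2018, Def 10 and the remark after it (§3.2, arXiv v2 p0011); Thm 4] -/
theorem exists_biregular_expander_fgl18 (dA dB : ℕ) (hA : 9 ≤ dA) (hB : 9 ≤ dB) :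
    ∃ γ δ : ℝ, 0 < γ ∧ 0 < δ ∧ 0 < betaZero dA dB δ δ ∧
      ∀ n : ℕ, ∃ H : Matrix (Fin dA × Fin n) (Fin dB × Fin n) (ZMod 2),
        Literature.InformationTheory.QuantumCodes.IsBiregular H dA dB ∧
        Literature.InformationTheory.QuantumCodes.IsLeftRightExpanding H dA dB γ δ γ δ := by
  have hA' : (9 : ℝ) ≤ dA := by exact_mod_cast hA
  have hB' : (9 : ℝ) ≤ dB := by exact_mod_cast hB
  obtain ⟨γ, hγ, h⟩ := exists_biregular_expander dA dB (2 / 17) (by nlinarith) (by nlinarith)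
  refine ⟨γ, 2 / 17, hγ, by norm_num, ?_, h⟩
  unfold betaZero
  have : (0 : ℝ) < (dA : ℝ) / dB := by positivity
  nlinarith

/-- **Non-vacuity of the LTZ15 hypotheses**: for all degrees `Δ_A, Δ_B ≥ 7` there are `γ > 0` and
`0 < δ < 1/6` (here `δ = 2/13`) such that `(Δ_A,Δ_B)`-biregular `(γ,δ,γ,δ)`-expanders exist for every size — the
hypotheses of `LTZ15_theorem2_le_holds` / `ltz15_theorem2_max` / `ltz15_theorem2_transpose` ("the graph G
with the required expanding properties may be obtained by random choice with classical probabilistic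
arguments, as developed in [Bas81] or [SS96]", LTZ15 after Thm 2 — there for random biregular graphs; here by
random lifts, exactly biregular). [cite: LeverrierTillichZemor2015, Thm 2 and the remark after it (arXiv v1 p0006 L15-32)] -/
theorem exists_biregular_expander_ltz15 (dA dB : ℕ) (hA : 7 ≤ dA) (hB : 7 ≤ dB) :
    ∃ γ δ : ℝ, 0 < γ ∧ 0 < δ ∧ δ < 1 / 6 ∧
      ∀ n : ℕ, ∃ H : Matrix (Fin dA × Fin n) (Fin dB × Fin n) (ZMod 2),
        Literature.InformationTheory.QuantumCodes.IsBiregular H dA dB ∧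
        Literature.InformationTheory.QuantumCodes.IsLeftRightExpanding H dA dB γ δ γ δ := by
  have hA' : (7 : ℝ) ≤ dA := by exact_mod_cast hA
  have hB' : (7 : ℝ) ≤ dB := by exact_mod_cast hB
  obtain ⟨γ, hγ, h⟩ := exists_biregular_expander dA dB (2 / 13) (by nlinarith) (by nlinarith)
  exact ⟨γ, 2 / 13, hγ, by norm_num, by norm_num, h⟩

end Existence

end Summit.Ventures.QEC.Expanders
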